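import Literature.IUT.LogVolume.TensorPacketHull
import Literature.IUT.LogVolume.TensorPacketMeasure
import Literature.IUT.LogVolume.TensorPacketShellHull
import Literature.IUT.LogVolume.PacketDifferent
import Literature.IUT.LogVolume.LogUnitsTraceZeroCoradial
import HarnessLib

/-!
# [IUTchIII] Thm 3.11 (i) (Ind1)+(Ind2) on a TENSOR PACKET `⊗_{ℚ_p} K_{v_b}`: the trace-zero part of `log_p(R_I^×)` is HULL-EQUIVALENT to
# `log_p(R_I^×)` as soon as ONE factor is tame of degree `≥ 2` (packet form of the washout; UNCONDITIONAL, print-free)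

PROOF-ONLY file (abc-iut cell, Cor. 3.12 sub-crew, seat abc-iut-c312-1 = holder of record of the typed [IUTchIII] Thm. 3.11, gen 15; row
«R20 = PACKET-HULL-WASHOUT», the tensor-packet half of the C LEAD's keyed row «C:IND1-STRIP-OV-HULL»; STAGED for TEAM R c312-14 / the C LEAD's
ruling).  TAKES NO SIDE on [IUTchIII] Cor. 3.12.

WHY.  At ONE place the ceiling of the print-(Ind1)⊔(Ind2) orbit span differs from Dupuy–Hilado's container span only in the trace line, and
that residue is washed out by the `𝒪_{K_v}`-hull because `log_p(𝒪_v^×) ∩ Ker Tr` is co-radial (`Thm311RealInd1StripHull`, p528030).  On a tensor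
packet `V = ⊗_{ℚ_p, b} K_{v_b}` of GENUINE completions the print group acts FACTORWISE (`LDHGenuinePerImagePrintInd1`, p516014), each factor
multiplying traces by a unit, so the natural packet ceiling is the TRACE-ZERO part `log_p(R_I^×) ∩ Ker Tr_{V/ℚ_p}` of the log-shell lattice
(`Tr_V(⊗ z_b) = Π_b Tr(z_b)`, abc-iut-S6 `trace_purePacket`).  THIS FILE proves the packet washout, print-free:

* §1 `norm_apply_le_of_mem_smul_logPacket` (each factor's compact `log_p(𝒪^×)` attains its maximal norm `r_b`) — under ANY
  decomposition `ψ : V ≃ₐ Π_j L_j` into local fields (abc-iut-S8; `σ_{bj} = (ψ ∘ ι_b)_j` isometric, `norm_factorEmb`) every element of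
  `c·log_p(R_I^×)` has `j`-component of norm `≤ ‖c‖·Π_b r_b`, `r_b = max‖log_p(𝒪_{v_b}^×)‖` (closure induction: pure log tensors go to products);
* §2 **`packetHull_smul_inter_ker_trace_eq`** — if ONE factor `b₀` is TAME (`p > 2`, `e ≤ p − 2`) of degree `≥ 2`, then for every `c ∈ ℚ_p`
  `hull(c·(log_p(R_I^×) ∩ Ker Tr_V)) = hull(c·log_p(R_I^×))` for the intrinsic `(R_I)^∼`-hull `packetHull` (abc-iut-S2): the pure tensor
  `w_{b₀} ⊗ ⊗_{b ≠ b₀} z_b^max` (`w_{b₀}` the co-radial trace-zero log-unit of `Literature…TraceZeroCoradial`, p527172) is trace-zero and realises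
  the maximal `j`-radius `‖c‖·Π_b r_b` in EVERY component `j`, so both sets have the same hull radii, hence (tree `HolomorphicHull` +
  `packetHull_eq_preimage_holomorphicHull`) the same hull; `packetHull_union_smul_inter_ker_trace_eq` — consequently for every region
  `M ⊆ hull(c·log_p(R_I^×))`: `hull(M ∪ c·(log_p(R_I^×) ∩ Ker Tr_V)) = hull(c·log_p(R_I^×))` — adding the trace-zero sublattice to ANY region of
  content `c` already fills the container's hull (Dupuy–Hilado: the `indTwo`-orbit of a content-`c` region spans `c·log_p(R_I^×)`,
  `TensorPacketOrbitSpan`); decomposition-free forms via the chosen `dEquiv` (abc-iut-S8 `TensorPacketMeasure`).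
READING (numbers about OUR typed objects): at a tensor packet with at least one tame factor of degree `≥ 2`, the trace rigidity of print's
(Ind1) strip part can save NOTHING at the level of holomorphic hulls relative to Dupuy–Hilado's container: any sub-indeterminacy whose orbit span
reaches the trace-zero ceiling has exactly the container's Θ-side hull.  Packets all of whose factors have degree 1 carry no strip part at all
(this lineage, p453109): there print's (Ind1)⊔(Ind2) is the unit scalars and the gain is ZERO (abc-iut-c312-d1).  The factorwise ceiling itself
(uniform unit scalars per factor) and the conditional floor are the sequel.  HONEST SCOPE: classical packet algebra + the cited tree typings;
wild factors not treated; nothing here computes a log-volume; no side taken on [IUTchIII] Cor. 3.12; NO abc claim. [claim: Mochizuki2012,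
status: disputed]; [cite: Mochizuki2012, IUTchIII Rmk. 3.9.5 (i) p. 127; Thm. 3.11 (i) p. 154; IUTchIV Prop. 1.2 (i) p. 10, Prop. 1.4 (i) p. 13];
[cite: DupuyHilado2025, §4.9, §4.12]. typed ≠ proved.
-/

set_option autoImplicit false

noncomputable section

open Metric Set Bornology
open scoped Pointwise TensorProduct

namespace Summit.ABC.IUTFork.Thm311.Real.PacketHull

open Literature.IUT.LogVolume

variable (p : ℕ) [Fact p.Prime]
variable {I : Type} [Fintype I] [DecidableEq I] [Nonempty I]
variable (k : I → Type) [∀ i, NontriviallyNormedField (k i)] [∀ i, NormedAlgebra ℚ_[p] (k i)]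
  [∀ i, IsUltrametricDist (k i)] [∀ i, ProperSpace (k i)]

/-! ## §1 Radii of `c·log_p(R_I^×)` under a decomposition -/

omit [Nonempty I] [∀ i, IsUltrametricDist (k i)] in
/-- **Component norms on `c·log_p(R_I^×)`**: for a family `zmax` of norm-maximal log-units, every `x ∈ c·log_p(R_I^×)` has
`‖ψ(x)_j‖ ≤ ‖c‖·Π_b ‖zmax_b‖` in every component `j` (pure log tensors go to products of isometric images; `log_p(R_I^×)` is the additive
closure of the pure log tensors; ultrametric). [cite: Mochizuki2012, IUTchIV Prop. 1.4 (i) p. 13] [claim: Mochizuki2012, status: disputed] -/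
theorem norm_apply_le_of_mem_smul_logPacket {J : Type} (L : J → Type) [∀ j, NontriviallyNormedField (L j)]
    [∀ j, NormedAlgebra ℚ_[p] (L j)] [∀ j, IsUltrametricDist (L j)] (ψ : PacketAlgebra p k ≃ₐ[ℚ_[p]] (Π j, L j))
    (zmax : Π i, k i) (hmax : ∀ i, ∀ w ∈ logUnits (k i), ‖w‖ ≤ ‖zmax i‖)
    (c : ℚ_[p]) {x : PacketAlgebra p k} (hx : x ∈ c • (logPacket p k : Set (PacketAlgebra p k))) (j : J) :
    ‖ψ x j‖ ≤ ‖c‖ * ∏ i, ‖zmax i‖ := by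
  obtain ⟨y, hy, rfl⟩ := Set.mem_smul_set.mp hx
  clear hx
  have hyj : ‖ψ y j‖ ≤ ∏ i, ‖zmax i‖ := by
    induction hy using AddSubgroup.closure_induction with
    | mem t ht =>
      obtain ⟨z, hz, rfl⟩ := ht
      rw [psi_purePacket_apply, norm_prod]
      exact Finset.prod_le_prod (fun i _ => norm_nonneg _) fun i _ => by
        rw [norm_factorEmb]; exact hmax i (z i) (hz i)
    | zero => rw [map_zero, Pi.zero_apply, norm_zero]; exact Finset.prod_nonneg fun i _ => norm_nonneg _
    | add a b _ _ ha hb =>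
      rw [map_add, Pi.add_apply]
      exact (IsUltrametricDist.norm_add_le_max _ _).trans (max_le ha hb)
    | neg a _ ha => rw [map_neg, Pi.neg_apply, norm_neg]; exact ha
  rw [map_smul, Pi.smul_apply, norm_smul]
  exact mul_le_mul_of_nonneg_left hyj (norm_nonneg c)

/-! ## §2 The washout: one co-radial factor -/

/-- **PACKET HULL WASHOUT (one tame factor of degree `≥ 2`; decomposition form).**  If the factor `i₀` is tame (`p > 2`, `e ≤ p − 2`) of degree
`≥ 2`, then for every `c ∈ ℚ_p` the sets `c·(log_p(R_I^×) ∩ Ker Tr_{V/ℚ_p})` and `c·log_p(R_I^×)` have THE SAME hull radii under `ψ`, hence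
the same holomorphic hull, hence the same intrinsic `(R_I)^∼`-hull: `packetHull(c·(log_p(R_I^×) ∩ Ker Tr_V)) = packetHull(c·log_p(R_I^×))`.
The witness is the pure tensor `c·(w_{i₀} ⊗ ⊗_{i≠i₀} z_i^max)`, `w_{i₀}` a co-radial trace-zero log-unit (`TraceZeroCoradial`).
[cite: Mochizuki2012, IUTchIII Rmk. 3.9.5 (i) p. 127; IUTchIV Prop. 1.4 (i) p. 13] [cite: DupuyHilado2025, §4.12] [claim: Mochizuki2012, status: disputed] -/
theorem packetHull_smul_inter_ker_trace_eq_of_decomp {J : Type} (L : J → Type) [∀ j, NontriviallyNormedField (L j)]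
    [Fintype J] [∀ j, NormedAlgebra ℚ_[p] (L j)] [∀ j, IsUltrametricDist (L j)] [∀ j, ProperSpace (L j)]
    (ψ : PacketAlgebra p k ≃ₐ[ℚ_[p]] (Π j, L j))
    (i₀ : I) (hp2 : 2 < p) (he : absRamificationIdx p (k i₀) ≤ p - 2)
    (hd : 2 ≤ Module.finrank ℚ_[p] (k i₀)) (c : ℚ_[p]) :
    packetHull p k (c • ((logPacket p k : Set (PacketAlgebra p k)) ∩
        {x | Algebra.trace ℚ_[p] (PacketAlgebra p k) x = 0})) =
      packetHull p k (c • (logPacket p k : Set (PacketAlgebra p k))) := by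
  classical
  -- norm-maximal log-units in every factor, the trace-zero co-radial one at `i₀`
  have hmaxes : ∀ i : I, ∃ z ∈ logUnits (k i), ∀ w ∈ logUnits (k i), ‖w‖ ≤ ‖z‖ := by
    intro i
    obtain ⟨z, hz, hmax⟩ := (isCompact_logUnits (p := p) (k i)).exists_isMaxOn ⟨0, zero_mem_logUnits (p := p)⟩
      continuous_norm.continuousOn
    exact ⟨z, hz, fun w hw => hmax hw⟩
  choose zm hzm hzmax using hmaxes
  obtain ⟨w, hwL, hwT, -, hwmax⟩ :=
    TraceZeroCoradial.exists_mem_logUnits_trace_eq_zero_isMaxOn_of_tame p (k i₀) hp2 he hd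
  let z : Π i, k i := Function.update zm i₀ w
  have hz : ∀ i, z i ∈ logUnits (k i) := by
    intro i
    by_cases hi : i = i₀
    · subst hi; simp only [z, Function.update_self]; exact hwL
    · simp only [z, Function.update_of_ne hi]; exact hzm i
  have hzmax : ∀ i, ∀ w' ∈ logUnits (k i), ‖w'‖ ≤ ‖z i‖ := by
    intro i w' hw'
    by_cases hi : i = i₀
    · subst hi; simp only [z, Function.update_self]; exact hwmax w' hw'
    · simp only [z, Function.update_of_ne hi]; exact hzmax i w' hw'
  set A : Set (PacketAlgebra p k) := c • ((logPacket p k : Set (PacketAlgebra p k)) ∩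
    {x | Algebra.trace ℚ_[p] (PacketAlgebra p k) x = 0}) with hA
  set B : Set (PacketAlgebra p k) := c • (logPacket p k : Set (PacketAlgebra p k)) with hB
  set R : J → ℝ := fun j => ‖c‖ * ∏ i, ‖z i‖ with hR
  have hAB : A ⊆ B := Set.smul_set_mono Set.inter_subset_left
  -- the witness
  set t : PacketAlgebra p k := purePacket p k z with ht
  have htL : t ∈ (logPacket p k : Set (PacketAlgebra p k)) := purePacket_mem_logPacket_of_mem p k hz
  have htT : Algebra.trace ℚ_[p] (PacketAlgebra p k) t = 0 := by
    rw [ht, trace_purePacket]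
    exact Finset.prod_eq_zero (Finset.mem_univ i₀) (by simp only [z, Function.update_self]; exact hwT)
  have hctA : c • t ∈ A := Set.smul_mem_smul_set ⟨htL, htT⟩
  have hnorm_t : ∀ j, ‖ψ (c • t) j‖ = R j := by
    intro j
    rw [map_smul, Pi.smul_apply, norm_smul, ht, psi_purePacket_apply, norm_prod]
    simp only [norm_factorEmb, R]
  -- radii bounds
  have hBle : ∀ x ∈ B, ∀ j, ‖ψ x j‖ ≤ R j := fun x hx j => norm_apply_le_of_mem_smul_logPacket p k L ψ z hzmax c hx j
  have hR0 : ∀ j, 0 ≤ R j := fun j => mul_nonneg (norm_nonneg c) (Finset.prod_nonneg fun i _ => norm_nonneg _)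
  have hBbdd : IsBounded (ψ '' B) := by
    refine (isBounded_polydisc L R).subset ?_
    rintro _ ⟨x, hx, rfl⟩
    exact (mem_polydisc L).mpr (hBle x hx)
  have hAbdd : IsBounded (ψ '' A) := hBbdd.subset (Set.image_mono hAB)
  have hradB : ∀ j, hullRadius L (ψ '' B) j = R j := by
    intro j
    refine le_antisymm (hullRadius_le_of_nonneg L (hR0 j) ?_) ?_
    · rintro _ ⟨x, hx, rfl⟩; exact hBle x hx j
    · rw [← hnorm_t j]
      exact norm_apply_le_hullRadius L hBbdd ⟨c • t, hAB hctA, rfl⟩ j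
  have hradA : ∀ j, hullRadius L (ψ '' A) j = R j := by
    intro j
    refine le_antisymm ((hullRadius_mono L hBbdd (Set.image_mono hAB) j).trans (hradB j).le) ?_
    rw [← hnorm_t j]
    exact norm_apply_le_hullRadius L hAbdd ⟨c • t, hctA, rfl⟩ j
  have hhull : holomorphicHull L (ψ '' A) = holomorphicHull L (ψ '' B) := by
    rw [holomorphicHull_of_isBounded L hAbdd, holomorphicHull_of_isBounded L hBbdd]
    congr 1
    funext j
    rw [hradA, hradB]
  rw [packetHull_eq_preimage_holomorphicHull p k L ψ hAbdd, packetHull_eq_preimage_holomorphicHull p k L ψ hBbdd, hhull]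

/-- **PACKET HULL WASHOUT (intrinsic form).**  If one factor `i₀` of the genuine packet `V = ⊗_{ℚ_p} K_{v_b}` is tame (`p > 2`, `e ≤ p − 2`) of
degree `≥ 2`, then for every `c ∈ ℚ_p`: `packetHull(c·(log_p(R_I^×) ∩ Ker Tr_{V/ℚ_p})) = packetHull(c·log_p(R_I^×))` — the trace-zero part of
the log-shell lattice already has the hull of the whole container span (read through the chosen decomposition `dEquiv`, abc-iut-S8; the hull does
not depend on it). [cite: Mochizuki2012, IUTchIII Rmk. 3.9.5 (i) p. 127] [cite: DupuyHilado2025, §4.9, §4.12] [claim: Mochizuki2012, status: disputed] -/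
theorem packetHull_smul_inter_ker_trace_eq (i₀ : I) (hp2 : 2 < p) (he : absRamificationIdx p (k i₀) ≤ p - 2)
    (hd : 2 ≤ Module.finrank ℚ_[p] (k i₀)) (c : ℚ_[p]) :
    packetHull p k (c • ((logPacket p k : Set (PacketAlgebra p k)) ∩
        {x | Algebra.trace ℚ_[p] (PacketAlgebra p k) x = 0})) =
      packetHull p k (c • (logPacket p k : Set (PacketAlgebra p k))) :=
  packetHull_smul_inter_ker_trace_eq_of_decomp p k (DFac p k) (dEquiv p k) i₀ hp2 he hd c

/-- **Adding the trace-zero sublattice to ANY region of content `c` fills the container's hull.**  Under the same hypothesis, for every region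
`M ⊆ packetHull(c·log_p(R_I^×))` (e.g. a Θ-region `ι(t)·(R_I)^∼` of content `c`): `packetHull(M ∪ c·(log_p(R_I^×) ∩ Ker Tr_V)) =
packetHull(c·log_p(R_I^×))` — the packet form of «ceiling hull = container hull» (one place: p528030).
[cite: Mochizuki2012, IUTchIII Rmk. 3.9.5 (i) p. 127; Cor. 3.12 Step (xi) p. 183] [cite: DupuyHilado2025, §4.12] [claim: Mochizuki2012, status: disputed] -/
theorem packetHull_union_smul_inter_ker_trace_eq (i₀ : I) (hp2 : 2 < p) (he : absRamificationIdx p (k i₀) ≤ p - 2)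
    (hd : 2 ≤ Module.finrank ℚ_[p] (k i₀)) (c : ℚ_[p]) {M : Set (PacketAlgebra p k)}
    (hM : M ⊆ packetHull p k (c • (logPacket p k : Set (PacketAlgebra p k)))) :
    packetHull p k (M ∪ c • ((logPacket p k : Set (PacketAlgebra p k)) ∩
        {x | Algebra.trace ℚ_[p] (PacketAlgebra p k) x = 0})) =
      packetHull p k (c • (logPacket p k : Set (PacketAlgebra p k))) := by
  apply Set.Subset.antisymm
  · rw [← packetHull_packetHull p k (c • (logPacket p k : Set (PacketAlgebra p k)))]
    exact packetHull_mono p k (Set.union_subset hM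
      ((Set.smul_set_mono Set.inter_subset_left).trans (subset_packetHull p k _)))
  · rw [← packetHull_smul_inter_ker_trace_eq p k i₀ hp2 he hd c]
    exact packetHull_mono p k Set.subset_union_right

end Summit.ABC.IUTFork.Thm311.Real.PacketHull

end
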